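import Summits.AnomalousDissipation.AnomalousDissipation.Theorems.SawtoothPulseCascadeK1LocalisedCascadeLedgerFeedGeometric

/-!
# K1loc — THE GRADE-AGNOSTIC PHASE-STEP FRAME AND THE PREFIX + GEOMETRIC-TAIL CLOSER (composition layer)

Helper file of the prover lane on the crux `K1LocalisedCascade` (stmt-AnomalousDissipation-19491), route `SawtoothPulseCascade`
(S-B/S-C assembly seat; the LEDGER ASSEMBLY, composition layer; arbiter A23-13 (4) / A23-14: «make the composition `PhaseStep`
GENERIC in the four half-step dischargers … so CT instances (j = 2, 3) and the Osc instances (j ≥ 4) plug into ONE frame»).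

The tracked energy of the fibre ledger at phase `j` is `E_j = S_j(K_j) + O_j(K_j)` (strip `|k₀| < K_j` plus the off-cone class
`K_j ≤ |k₀| ∧ u|k₀| ≤ v|k₁|` of the inviscid iterate `a_j`).  ONE PHASE of ANY grade (plain kernel, Log2, Osc, CT input-free) is
the data of three half-step windows and two feed bounds IN ADDITIVE SHAPE — the shape of `K1Start.phaseTwo_start_le` (ad-k1loc-p3):
* (T-H) `T_j(K′) ≤ S_j(K) + O_j(K) + j_T` (low `V`-fibres of `b_j` from the strip and the off-cone class of `a_j`),
* (S-V) `S_{j+1}(K″) ≤ T_j(K′) + C¹_j + j_S` (next strip from the low fibres and the feed class `C¹_j` of `b_j`),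
* (O-V) `O_{j+1}(K″) ≤ C²_j + j_O` (next off-cone class from the feed class `C²_j` of `b_j`),
* feeds `C¹_j ≤ c₁`, `C²_j ≤ c₂` (through their own windows (C-H) and the shell cap, or any other bound),
giving `E_{j+1} ≤ E_j + (j_T + j_S + j_O + c₁ + c₂)` (`energy_step_of_additive_windows`; Fourier form `phase_step_of_dischargers`,
with the off-cone slope allowed to CHANGE across the phase — the fat → thin junction widens it).  The squared-amplitude windows of the
Osc/Log2/plain grades, `x ≤ base + (w + √F)² + f`, are put in additive shape by `le_add_add_of_sq_window` (`(w + √F)² ≤ F + w² + 2wc`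
for `√F ≤ c`); `…LedgerFeedChain.strip_offCone_resolved_step` is the instance with all five windows of that kind.

The closer for a ledger with an EXPLICIT FINITE PREFIX of increments (phases `j₀ ≤ j < j₁`: start box, CT phases, fat Osc phases —
finitely many certified numbers) and a GEOMETRIC TAIL (`ℓ_{j₁+i} ≤ C·θ^i`, the thin phases): `tsum_shift_le_of_prefix_geometric`
(`Σ'_i ℓ_{j₀+i} ≤ Σ_{j₀≤j<j₁} ℓ_j + C/(1−θ)`) and **`k1Localised_of_prefix_geometric_ledger`** (= `k1Localised_of_energy_ledger` with the
budget `T_{j₀} + Σ_{j₀≤j<j₁} ℓ_j + C/(1−θ) < ‖datum‖²`).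
Pure real bookkeeping; no definitions; nothing about `δ₀ = ¼`; no statement about the crux.
[cite: DEIJ2022, (1.2)–(1.3)] [cite: ElgindiLissMattingly2025, §1.2.2 and §3.1] [cite: Grafakos2014, Prop. 3.2.7 (3)] [problem: turb]
-/

-- `Summit.<Summit>.<Problem>`: single-conjunct summit, the duplicate namespace segment is deliberate.
set_option linter.dupNamespace false

noncomputable section

namespace Summit.AnomalousDissipation.AnomalousDissipation.Theorems.SawtoothPulseCascade.K1Ledger.From

open MeasureTheory Set Filter Topology UnitAddTorus Function
open scoped ENNReal
open Literature.Analysis Literature.Analysis.FunctionSpaces Literature.Analysis.FunctionSpaces.Torus Literature.Analysis.FluidPDE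
open Literature.Analysis.FluidPDE.ShearStage
open Literature.Analysis.FluidPDE.SawtoothCascade Literature.Analysis.FluidPDE.SawtoothCascade.CascadeParams
open Summit.AnomalousDissipation.AnomalousDissipation.Theorems.SawtoothPulseCascade.K1Window

/-! ## §1 One phase in additive shape -/

/-- **THE GRADE-AGNOSTIC PHASE STEP** (additive shape): (T-H) `T ≤ S + O + j_T`, (S-V) `S' ≤ T + C₁ + j_S`, (O-V) `O' ≤ C₂ + j_O`,
feeds `C₁ ≤ c₁`, `C₂ ≤ c₂` give `S' + O' ≤ S + O + (j_T + j_S + j_O + c₁ + c₂)`. [folklore] -/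
theorem energy_step_of_additive_windows {S T O S' O' C₁ C₂ jT jS jO c₁ c₂ : ℝ}
    (hT : T ≤ S + O + jT) (hS : S' ≤ T + C₁ + jS) (hO : O' ≤ C₂ + jO) (hC₁ : C₁ ≤ c₁) (hC₂ : C₂ ≤ c₂) :
    S' + O' ≤ S + O + (jT + jS + jO + c₁ + c₂) := by
  linarith

/-- **The next off-cone class in additive shape**: (O-V) `O' ≤ C₂ + j_O` and `C₂ ≤ c₂` give `O' ≤ c₂ + j_O` (the input `√O' ≤ o'`,
`o' = √(c₂ + j_O)`, of the next phase's (T-H) window). [folklore] -/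
theorem offCone_next_of_additive_window {O' C₂ jO c₂ : ℝ} (hO : O' ≤ C₂ + jO) (hC₂ : C₂ ≤ c₂) : O' ≤ c₂ + jO := by
  linarith

/-- **A squared-amplitude window in additive shape**: `x ≤ base + (w + √F)² + f` with `0 ≤ w`, `0 ≤ F` and an amplitude bound
`√F ≤ c` gives `x ≤ base + F + (w² + 2wc + f)` (`(w + √F)² = w² + 2w√F + F`). [folklore] -/
theorem le_add_add_of_sq_window {x base w F f c : ℝ} (h : x ≤ base + (w + Real.sqrt F) ^ 2 + f) (hw : 0 ≤ w) (hF : 0 ≤ F)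
    (hc : Real.sqrt F ≤ c) : x ≤ base + F + (w ^ 2 + 2 * w * c + f) := by
  have e : (w + Real.sqrt F) ^ 2 = w ^ 2 + 2 * w * Real.sqrt F + F := by rw [add_sq, Real.sq_sqrt hF]
  have : 2 * w * Real.sqrt F ≤ 2 * w * c := mul_le_mul_of_nonneg_left hc (by linarith)
  linarith

/-- **A squared-amplitude window without base in additive shape**: `x ≤ (w + √F)² + f`, `0 ≤ w`, `0 ≤ F`, `√F ≤ c` give
`x ≤ F + (w² + 2wc + f)`. [folklore] -/
theorem le_add_of_sq_window {x w F f c : ℝ} (h : x ≤ (w + Real.sqrt F) ^ 2 + f) (hw : 0 ≤ w) (hF : 0 ≤ F)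
    (hc : Real.sqrt F ≤ c) : x ≤ F + (w ^ 2 + 2 * w * c + f) := by
  have := le_add_add_of_sq_window (base := 0) (by simpa only [zero_add] using h) hw hF hc
  linarith

/-- **A feed through a squared-amplitude window with a capped source**: `C ≤ (w + √A)² + f` with `√A ≤ 𝔞`, `0 ≤ w` gives the
feed bound `C ≤ (w + 𝔞)² + f` (the `c_i` of `energy_step_of_additive_windows`). [folklore] -/
theorem feed_le_of_sq_window {C w A 𝔞 f : ℝ} (h : C ≤ (w + Real.sqrt A) ^ 2 + f) (hw : 0 ≤ w)
    (h𝔞 : Real.sqrt A ≤ 𝔞) : C ≤ (w + 𝔞) ^ 2 + f :=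
  h.trans (add_le_add (pow_le_pow_left₀ (add_nonneg hw (Real.sqrt_nonneg _)) (add_le_add le_rfl h𝔞) 2) le_rfl)

/-- **The amplitude of a window bound**: `x ≤ (w + c)² + f` with `0 ≤ w + c`, `0 ≤ f` gives `√x ≤ w + c + √f`. [folklore] -/
theorem sqrt_le_of_sq_window {x w c f : ℝ} (h : x ≤ (w + c) ^ 2 + f) (hwc : 0 ≤ w + c) (hf : 0 ≤ f) :
    Real.sqrt x ≤ w + c + Real.sqrt f := by
  have h0 : 0 ≤ w + c + Real.sqrt f := add_nonneg hwc (Real.sqrt_nonneg _)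
  calc Real.sqrt x ≤ Real.sqrt ((w + c + Real.sqrt f) ^ 2) :=
        Real.sqrt_le_sqrt (h.trans (by nlinarith [Real.sq_sqrt hf, Real.sqrt_nonneg f]))
    _ = w + c + Real.sqrt f := Real.sqrt_sq h0

/-! ## §2 The phase step in Fourier form (any thresholds, any grade; the off-cone slope may change across the phase) -/

/-- **THE GRADE-AGNOSTIC PHASE STEP OF THE FIBRE LEDGER, FOURIER FORM.**  For the iterates `v = a_j`, `w = b_j`, `v' = a_{j+1}`,
thresholds `K` (strip of `a_j`), `K′` (low fibres of `b_j`), `K″` (strip of `a_{j+1}`), off-cone slopes `(u, v)` before and `(u′, v′)`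
after the phase, feed energies `C₁, C₂` and the five DISCHARGERS in additive shape (hT) (hS) (hO) (hC₁) (hC₂) of the file header:
`S_{j+1}(K″) + O′_{j+1}(K″) ≤ S_j(K) + O_j(K) + (j_T + j_S + j_O + c₁ + c₂)`. [cite: Grafakos2014, Prop. 3.2.7 (3)] -/
theorem phase_step_of_dischargers (v w v' : UnitAddTorus (Fin 2) → ℝ) (K K' K'' u₁ v₁ u₂ v₂ : ℕ) {C₁ C₂ jT jS jO c₁ c₂ : ℝ}
    (hT : ∑' k : Fin 2 → ℤ, (if |k 1| < (K' : ℤ) then (1 : ℝ) else 0) * ‖mFourierCoeff (fun x => (w x : ℂ)) k‖ ^ 2 ≤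
      ∑' k : Fin 2 → ℤ, (if |k 0| < (K : ℤ) then (1 : ℝ) else 0) * ‖mFourierCoeff (fun x => (v x : ℂ)) k‖ ^ 2 +
        ∑' k : Fin 2 → ℤ, (if (K : ℤ) ≤ |k 0| ∧ (u₁ : ℤ) * |k 0| ≤ (v₁ : ℤ) * |k 1| then (1 : ℝ) else 0) *
          ‖mFourierCoeff (fun x => (v x : ℂ)) k‖ ^ 2 + jT)
    (hS : ∑' k : Fin 2 → ℤ, (if |k 0| < (K'' : ℤ) then (1 : ℝ) else 0) * ‖mFourierCoeff (fun x => (v' x : ℂ)) k‖ ^ 2 ≤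
      ∑' k : Fin 2 → ℤ, (if |k 1| < (K' : ℤ) then (1 : ℝ) else 0) * ‖mFourierCoeff (fun x => (w x : ℂ)) k‖ ^ 2 + C₁ + jS)
    (hO : ∑' k : Fin 2 → ℤ, (if (K'' : ℤ) ≤ |k 0| ∧ (u₂ : ℤ) * |k 0| ≤ (v₂ : ℤ) * |k 1| then (1 : ℝ) else 0) *
        ‖mFourierCoeff (fun x => (v' x : ℂ)) k‖ ^ 2 ≤ C₂ + jO)
    (hC₁ : C₁ ≤ c₁) (hC₂ : C₂ ≤ c₂) :
    ∑' k : Fin 2 → ℤ, (if |k 0| < (K'' : ℤ) then (1 : ℝ) else 0) * ‖mFourierCoeff (fun x => (v' x : ℂ)) k‖ ^ 2 +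
        ∑' k : Fin 2 → ℤ, (if (K'' : ℤ) ≤ |k 0| ∧ (u₂ : ℤ) * |k 0| ≤ (v₂ : ℤ) * |k 1| then (1 : ℝ) else 0) *
          ‖mFourierCoeff (fun x => (v' x : ℂ)) k‖ ^ 2 ≤
      ∑' k : Fin 2 → ℤ, (if |k 0| < (K : ℤ) then (1 : ℝ) else 0) * ‖mFourierCoeff (fun x => (v x : ℂ)) k‖ ^ 2 +
        ∑' k : Fin 2 → ℤ, (if (K : ℤ) ≤ |k 0| ∧ (u₁ : ℤ) * |k 0| ≤ (v₁ : ℤ) * |k 1| then (1 : ℝ) else 0) *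
          ‖mFourierCoeff (fun x => (v x : ℂ)) k‖ ^ 2 + (jT + jS + jO + c₁ + c₂) :=
  energy_step_of_additive_windows hT hS hO hC₁ hC₂

/-! ## §3 Gluing a finite prefix of steps to a tail; the prefix + geometric-tail budget -/

/-- **Steps on a prefix and on a tail give steps from `j₀` on.** [folklore] -/
theorem steps_of_prefix_and_tail {T ℓ : ℕ → ℝ} {j₀ j₁ : ℕ}
    (hpre : ∀ j, j₀ ≤ j → j < j₁ → T (j + 1) ≤ T j + ℓ j) (htail : ∀ j, j₁ ≤ j → T (j + 1) ≤ T j + ℓ j) :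
    ∀ j, j₀ ≤ j → T (j + 1) ≤ T j + ℓ j := fun j hj =>
  (lt_or_ge j j₁).elim (hpre j hj) (htail j)

/-- **A finite segment, telescoped**: steps `T_{j₀+i+1} ≤ T_{j₀+i} + ℓ_{j₀+i}` for `i < n` give `T_{j₀+n} ≤ T_{j₀} + Σ_{i<n} ℓ_{j₀+i}`.
[folklore] -/
theorem le_add_sum_range_of_steps {T ℓ : ℕ → ℝ} {j₀ n : ℕ}
    (hstep : ∀ i, i < n → T (j₀ + i + 1) ≤ T (j₀ + i) + ℓ (j₀ + i)) :
    T (j₀ + n) ≤ T j₀ + ∑ i ∈ Finset.range n, ℓ (j₀ + i) := by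
  induction n with
  | zero => simp
  | succ n ih =>
    rw [Finset.sum_range_succ, ← add_assoc j₀ n 1]
    have h1 := ih fun i hi => hstep i (Nat.lt_succ_of_lt hi)
    linarith [hstep n (Nat.lt_succ_self n)]

/-- **Prefix + geometric tail**: a non-negative sequence `ℓ` with `ℓ_{j₁+i} ≤ C·θ^i` (`0 ≤ θ < 1`) is summable and, for `j₀ ≤ j₁`,
`Σ'_i ℓ_{j₀+i} ≤ Σ_{j₀ ≤ j < j₁} ℓ_j + C/(1−θ)`. [folklore] -/
theorem tsum_shift_le_of_prefix_geometric {ℓ : ℕ → ℝ} {j₀ j₁ : ℕ} {C θ : ℝ} (hθ0 : 0 ≤ θ) (hθ1 : θ < 1)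
    (hℓ0 : ∀ j, 0 ≤ ℓ j) (hℓ : ∀ i, ℓ (j₁ + i) ≤ C * θ ^ i) (hj : j₀ ≤ j₁) :
    Summable ℓ ∧ ∑' i, ℓ (j₀ + i) ≤ ∑ j ∈ Finset.Ico j₀ j₁, ℓ j + C / (1 - θ) := by
  obtain ⟨hs, htail⟩ := summable_and_tsum_le_of_shift_geometric (e := ℓ) (j₀ := j₁) hθ0 hθ1 hℓ0 hℓ
  refine ⟨hs, ?_⟩
  have hs0 : Summable fun i => ℓ (j₀ + i) := hs.comp_injective (add_right_injective j₀)
  have hsplit := hs0.sum_add_tsum_nat_add (j₁ - j₀)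
  have e1 : ∑ i ∈ Finset.range (j₁ - j₀), ℓ (j₀ + i) = ∑ j ∈ Finset.Ico j₀ j₁, ℓ j := by
    rw [Finset.sum_Ico_eq_sum_range]
  have e2 : (fun i => ℓ (j₀ + (i + (j₁ - j₀)))) = fun i => ℓ (j₁ + i) := by
    funext i; congr 1; omega
  rw [e1, e2] at hsplit
  linarith

section Cascade

variable (P : CascadeParams)

/-- **`K1Localised P (γ² − 3)` FROM AN ENERGY LEDGER WITH AN EXPLICIT PREFIX AND A GEOMETRIC TAIL** (shape P, `L_min ≥ 1000`):
the data of `k1Localised_of_energy_ledger` — ANY `c > 0`, tracked energies `T_n` dominating `LowBand_n(c) + HighOffCone_n(c)` for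
`n ≥ i₁`, steps `T_{j+1} ≤ T_j + ℓ_j` for `j ≥ j₀`, `ℓ ≥ 0` — with summability and budget REPLACED by: a phase `j₁ ≥ j₀`, a tail bound
`ℓ_{j₁+i} ≤ C·θ^i` (`0 ≤ θ < 1`) and the budget `T_{j₀} + Σ_{j₀ ≤ j < j₁} ℓ_j + C/(1−θ) < ‖datum‖²` (the prefix increments are the
finitely many certified per-phase numbers: start box, CT phases, fat Osc phases; the tail is the thin segment).
[cite: DEIJ2022, (1.2)–(1.3)] [cite: ElgindiLissMattingly2025, §1.2.2 and §3.1] [cite: Grafakos2014, Prop. 3.2.7 (3)] -/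
theorem k1Localised_of_prefix_geometric_ledger (hγ : 5 ≤ P.γ) (hγ' : P.γ ≤ 8) (hδ₀ : 0 < P.δ₀)
    (hδ₀' : P.δ₀ ≤ 1 / 4) (hd : P.d = 2) (hN₀ : P.N₀ = 1) (hρN : P.ρN = 2) {Lm : ℝ} (hLm : 1000 ≤ Lm)
    (a b : ℕ → UnitAddTorus (Fin 2) → ℝ) (has : ∀ j, IsSmooth (a j)) (h0 : a 0 = datum)
    (hb : ∀ j, b j = a j ∘ shearMap 0 1 (amp ⟨P.U j, P.U_periodic j, P.contDiff_U (P.δ_pos hδ₀ (by rw [hd]; norm_num) j)⟩ P.γ))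
    (hab : ∀ j, a (j + 1) = b j ∘ shearMap 1 0 (amp ⟨P.U j, P.U_periodic j, P.contDiff_U (P.δ_pos hδ₀ (by rw [hd]; norm_num) j)⟩ P.γ))
    {c : ℝ} (hc : 0 < c) (T ℓ : ℕ → ℝ) {i₁ j₀ j₁ : ℕ} (hj : j₀ ≤ j₁)
    (hdom : ∀ n : ℕ, i₁ ≤ n →
      ∑' k : Fin 2 → ℤ, (if |((k 0 : ℤ) : ℝ)| < (1 + 1 / 250) * (c * (P.γ ^ 2 - 3) ^ n) then (1 : ℝ) else 0) *
          ‖mFourierCoeff (fun x => (a n x : ℂ)) k‖ ^ 2 +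
        ∑' k : Fin 2 → ℤ, (if (1 + 1 / 250) * (c * (P.γ ^ 2 - 3) ^ n) ≤ |((k 0 : ℤ) : ℝ)| ∧
            13 / 10 * |((k 0 : ℤ) : ℝ)| < P.γ * |((k 1 : ℤ) : ℝ)| then (1 : ℝ) else 0) *
          ‖mFourierCoeff (fun x => (a n x : ℂ)) k‖ ^ 2 ≤ T n)
    (hstep : ∀ j, j₀ ≤ j → T (j + 1) ≤ T j + ℓ j) (hℓ0 : ∀ j, 0 ≤ ℓ j)
    {C θ : ℝ} (hθ0 : 0 ≤ θ) (hθ1 : θ < 1) (hℓ : ∀ i, ℓ (j₁ + i) ≤ C * θ ^ i)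
    (hbudget : T j₀ + ∑ j ∈ Finset.Ico j₀ j₁, ℓ j + C / (1 - θ) < Torus.scalarL2Sq datum) :
    K1Localised P (P.γ ^ 2 - 3) := by
  obtain ⟨hℓs, htsum⟩ := tsum_shift_le_of_prefix_geometric hθ0 hθ1 hℓ0 hℓ hj
  exact k1Localised_of_energy_ledger P hγ hγ' hδ₀ hδ₀' hd hN₀ hρN hLm a b has h0 hb hab hc T ℓ (i₁ := i₁) (j₀ := j₀) hdom
    hstep hℓ0 hℓs (by linarith)

end Cascade

end Summit.AnomalousDissipation.AnomalousDissipation.Theorems.SawtoothPulseCascade.K1Ledger.From
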